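import Literature.Computability.Cryptography.ChenQuantumLWENonDemolition

/-!
# Coset-restricted non-demolition operations on the Step-9 line kets are still class-blind (T4, operator form, N-12.4)

REPRODUCTION / ANALYSIS OF A CLAIMED RESULT UNDER ADJUDICATION (withdrawn): Yilei Chen, *Quantum
Algorithms for Lattice Problems*, IACR ePrint 2024/555, version of 2024-04-18 [ChenQuantumLattice2024]
(the version carrying the author's note that Step 9 contains a bug), Step 9 (§3.5.9, pp. 34–38) acting
on the line ket `|φ8.b⟩ = Σ_{j ∈ ℤ_P} e(-j²/P) |2D²j·b + v′ mod N⟩` (p. 35), Claim 3.14 (pp. 33–34) and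
eq. (12) (p. 17).  Bundle `papers/QuantumAdvantage/lwe-quantum-autopsy/`, Part 2 (`REPAIR-CENSUS.md`
§1 **T4**, §12, §13; `REFEREE.md` N-12.4), sequel of `ChenQuantumLWENonDemolition.lean`.
HONEST FRAMING: kernel-checked THEOREMS about states occurring in a WITHDRAWN algorithm — a sharpening of
the operator form of a NO-GO for in-run repairs of Step 9, NOT summit progress, no cryptanalytic claim in
either direction, no new algorithm; quantum lower bounds are out of scope.

## What is proved

`ChenQuantumLWENonDemolition` showed that an operation which is non-demolition on the line ket of EVERY
class secret `b` and EVERY offset (`IsClassND`) has a class-blind eigenvalue.  A referee (N-12.4) asked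
for the honest weakening of the hypothesis: the algorithm need only guarantee state survival on the
instances CONSISTENT WITH WHAT IT KNOWS — by `offset_indistinguishable_iff` (`ChenQuantumLWELineInvariants`)
the line invariants and the Step-8 datum `v′₀ mod D²p₁` determine exactly the KNOWABLE COSET
`v′ + {d(a,c)} (mod N)` of the offset, `d(a,c) = D²p₁(a·bk + c·𝟙_U)` (`SameCoset`).  Call `E`
COSET-NON-DEMOLITION at `v′` (`IsCosetND`) if `E|φ_{b,w}⟩ ∈ ℂ|φ_{b,w}⟩` for every class secret `b` and
every `w` in that coset only (`isCosetND_iff_knowable` is the reformulation in knowable terms).  Then,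
for odd `P = p₁Q`, odd `Q`, `gcd(p₁,Q) = 1`, `0 ∉ U ≠ ∅`, `bk₀ = −1`:

* `sum_conj_chirp_p₁_smul_phi8bKet` — only the members `t ≡ 0 (mod p₁)` of the chirp family through
  `v′` stay in the coset; they resolve not `|v′⟩` but the SUB-LINE KET
  `sublineKet b v′ = Σ_{j ≡ 0 (Q)} ψ_P(−j²)|2D²j·b + v′⟩` (character sum `Σ_t ψ_P(p₁t·(−2j)) = P·[Q ∣ j]`,
  `p₁_mul_eq_zero_iff`), and `InClass.sublineKet_eq`: this vector is the SAME for every class secret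
  (on `U` the direction `2D²j·b_i = 4D²p₁j·(b_i/2p₁)` vanishes mod `N` when `Q ∣ j`) — it lives on the
  public progression `v′ + ⟨2D²Q·bk⁰⟩`.
* `nd_sublineExpansion`, `IsCosetND.sublineCoeff_eq_ite` — hence `P·E(sublineKet)` expands along the line
  of any class secret with coefficients `ψ_P(−j²)·λ̂^Q(p₁·(−2j))`, `λ^Q(t) = λ(p₁t)` the (automatically
  `Q`-periodic, `sublineProfile_periodic`) eigenvalue profile along the sub-line, whose Fourier transform
  lives on `p₁ℤ_P` (`profileDFT_eq_zero_of_periodic`); two class secrets expand the same vector.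
* **`IsCosetND.ndValue_secret_indep`**, **`IsCosetND.ndValue_lineShift_p₁_mul`** — comparing two class
  secrets (lines through `v′` meet generically only at `v′`) and a secret with its bump `b + 2p₁𝟙_{i₀}`
  (lines meet only at parameters `≡ 0 (mod Q)`) gives secret independence and `p₁`-periodicity of the
  eigenvalue exactly as in the unrestricted case.
* **`IsCosetND.ndValue_classShift`**, **`IsCosetND.ndValue_eq_of_sameCoset`**, `IsCosetND.ndValue_class_blind`,
  **`IsCosetND.apply_eq_smul`** — every intermediate offset of the bump-and-slide argument is certified to
  stay in the knowable coset (`sameCoset_lineShift_p₁_mul`, `sameCoset_add_on`, `SameCoset.trans`,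
  `IsCosetND.of_sameCoset`), so the eigenvalue is ONE scalar on the whole knowable family
  `{|φ_{b,w}⟩ : b class secret, w ∈ v′ + {d(a,c)}}`: an instrument assembled from coset-non-demolition
  Kraus operators has an outcome law independent of the instance — it cannot supply the centre
  correction Step 9 needs (`ChenQuantumLWEClassTwirl.centreError` sweeps `ℤ_Q` over the coset).
* `IsClassND.isCosetND`, `isCosetND_branchOp_singleton`, `not_isClassND_branchOp_singleton` — the new
  hypothesis is STRICTLY WEAKER (a single-point branch off the invariant tube is coset-non-demolition but
  demolishes a line ket outside the coset), so `IsCosetND.ndValue_eq_of_sameCoset` strictly strengthens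
  `IsClassND.ndValue_class_blind`; `Shape.coset_ndValue_class_blind` is the version for Chen's admissible
  shapes (Cond. C.3).
* Numerics (bundle `numerics/b2b-lwe-2/gen7_coset_components.py`, exact arithmetic over two prime
  fields): the linear matroid of the knowable family is CONNECTED (rank `Q^{1+|U|}`, one component) on
  toy instances incl. `D = 3` and composite `Q = 15`, with the predicted controls (a single secret or
  `U = ∅` gives independent kets) — the operator statement read off independently of this file.

## What is NOT here

Operations that do disturb some ket of the knowable family (run-by-run covered by the class-twirl and
window theorems of the earlier modules); adaptive multi-copy strategies beyond the product structure of
`twirl_multiRun_indep`; the case `U = ∅` (no unknown coordinate: the `Q` kets of the family are then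
independent and a coset-non-demolition eigenvalue CAN read `v′₀ mod Q` — but there is no secret left);
quantum query lower bounds.
-/

namespace Literature.Computability.Cryptography.Chen2024

open scoped BigOperators

section General

variable {k m : ℕ}

/-- A scalar multiple of a line ket is the line ket of the scaled profile. [folklore] -/
theorem smul_lineKet {ι : Type*} [Fintype ι] (pt : ι → (Fin k → ZMod m)) (a : ℂ) (c : ι → ℂ) :
    a • lineKet pt c = lineKet pt (fun j => a * c j) := by
  funext z
  unfold lineKet
  simp only [Pi.smul_apply, smul_eq_mul, Finset.mul_sum, mul_ite, mul_zero]

end General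

section Coset

variable (n : ℕ) (D p₁ Q : ℕ+)

/-- `p₁·x = 0` in `ℤ_P` iff `x ≡ 0 (mod Q)` (`P = p₁Q`). [folklore] -/
theorem p₁_mul_eq_zero_iff (x : ZP p₁ Q) : ((p₁ : ℕ) : ZP p₁ Q) * x = 0 ↔ toQ p₁ Q x = 0 := by
  constructor
  · intro h
    have h1 : ((((p₁ : ℕ) * x.val : ℕ)) : ZP p₁ Q) = 0 := by
      rw [Nat.cast_mul, ZMod.natCast_zmod_val]; exact h
    have h2 : (p₁ : ℕ) * (Q : ℕ) ∣ (p₁ : ℕ) * x.val :=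
      (dvd_of_eq (PNat.mul_coe p₁ Q).symm).trans ((ZMod.natCast_eq_zero_iff _ _).1 h1)
    have hQ : (Q : ℕ) ∣ x.val := (Nat.mul_dvd_mul_iff_left (PNat.pos p₁)).1 h2
    rw [toQ, ZMod.castHom_apply, ZMod.cast_eq_val]
    exact (ZMod.natCast_eq_zero_iff _ _).2 hQ
  · intro h
    obtain ⟨y, rfl⟩ := exists_eq_Q_mul_of_toQ_eq_zero p₁ Q h
    rw [← mul_assoc, p₁_mul_Q_eq_zero, zero_mul]

/-- `Q·s = 0` in `ℤ_P` means `s = p₁·y`. [folklore] -/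
theorem exists_eq_p₁_mul_of_Q_mul_eq_zero {s : ZP p₁ Q} (h : ((Q : ℕ) : ZP p₁ Q) * s = 0) :
    ∃ y : ZP p₁ Q, s = ((p₁ : ℕ) : ZP p₁ Q) * y := by
  have h1 : (((s.val * (Q : ℕ) : ℕ)) : ZP p₁ Q) = 0 := by
    rw [Nat.cast_mul, ZMod.natCast_zmod_val, mul_comm]; exact h
  have h2 : (p₁ : ℕ) * (Q : ℕ) ∣ s.val * (Q : ℕ) :=
    (dvd_of_eq (PNat.mul_coe p₁ Q).symm).trans ((ZMod.natCast_eq_zero_iff _ _).1 h1)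
  obtain ⟨k, hk⟩ := Nat.dvd_of_mul_dvd_mul_right (PNat.pos Q) h2
  exact ⟨(k : ZP p₁ Q), by rw [← ZMod.natCast_zmod_val s, hk, Nat.cast_mul]⟩

/-- `−2j ≡ 0 (mod Q)` iff `j ≡ 0 (mod Q)` for odd `Q`. [folklore] -/
theorem toQ_neg_two_mul_eq_zero_iff (hQ : Odd ((Q : ℕ+) : ℕ)) (j : ZP p₁ Q) :
    toQ p₁ Q (-(2 * j)) = 0 ↔ toQ p₁ Q j = 0 := by
  rw [map_neg, map_mul, map_ofNat, neg_eq_zero]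
  exact (Literature.NumberTheory.GaussSums.isUnit_two_zmod_of_odd _ hQ).mul_right_eq_zero

/-- The Fourier transform of a `q`-periodic profile vanishes off the annihilator of `q`. [folklore] -/
theorem profileDFT_eq_zero_of_periodic (c : ZP p₁ Q → ℂ) (q : ZP p₁ Q) (hc : ∀ t, c (t + q) = c t)
    {s : ZP p₁ Q} (hs : q * s ≠ 0) : profileDFT p₁ Q c s = 0 := by
  have key : profileDFT p₁ Q c s = (ZMod.stdAddChar (q * s) : ℂ) * profileDFT p₁ Q c s := by
    unfold profileDFT
    rw [Finset.mul_sum]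
    calc ∑ j : ZP p₁ Q, c j * (ZMod.stdAddChar (j * s) : ℂ)
        = ∑ j : ZP p₁ Q, c (j + q) * (ZMod.stdAddChar ((j + q) * s) : ℂ) :=
          (Fintype.sum_equiv (Equiv.addRight q) _ _ (fun j => rfl)).symm
      _ = ∑ j : ZP p₁ Q, (ZMod.stdAddChar (q * s) : ℂ) * (c j * (ZMod.stdAddChar (j * s) : ℂ)) := by
          refine Finset.sum_congr rfl fun j _ => ?_
          rw [hc, add_mul, AddChar.map_add_eq_mul]
          push_cast
          ring
  have hne : (ZMod.stdAddChar (q * s) : ℂ) ≠ 1 := fun h =>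
    hs (stdAddChar_injective (h.trans (AddChar.map_zero_eq_one _).symm))
  have h0 : (1 - (ZMod.stdAddChar (q * s) : ℂ)) * profileDFT p₁ Q c s = 0 := by
    rw [sub_mul, one_mul, ← key, sub_self]
  exact (mul_eq_zero.1 h0).resolve_left (sub_ne_zero.2 hne.symm)

/-- THE SUB-LINE KET through the offset: the part of `|φ_{b,v′}⟩` on the parameters `j ≡ 0 (mod Q)`,
`Σ_{j ≡ 0 (Q)} ψ_P(−j²)|2D²j·b + v′⟩` — supported on the PUBLIC progression `v′ + ⟨2D²Q·bk⁰⟩` for a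
class secret `b`. [cite: ChenQuantumLattice2024, §3.5.9 p. 35] -/
noncomputable def sublineKet (b v' : Fin (n + 1) → ℤ) : Ket (n + 1) ((D * D * (p₁ * Q) : ℕ+) : ℕ) :=
  lineKet (ptB n D p₁ Q b v')
    (fun j => if toQ p₁ Q j = 0 then (ZMod.stdAddChar (-(j ^ 2) : ZP p₁ Q) : ℂ) else 0)

/-- On an unknown coordinate the direction step of a class secret vanishes at parameters `≡ 0 (mod Q)`:
`2D²·j·(2p₁β) ≡ 0 (mod D²p₁Q)` when `Q ∣ j`. [cite: ChenQuantumLattice2024, eq. (12) p. 17] -/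
theorem twoDsq_mul_eq_zero_of_dvd {j : ℕ} (hj : (Q : ℕ) ∣ j) {β : ℤ} (hβ : (2 * ((p₁ : ℕ) : ℤ)) ∣ β) :
    ((2 * ((D : ℕ) : ℤ) ^ 2 * (j : ℤ) * β : ℤ) : ZN D p₁ Q) = 0 := by
  obtain ⟨k, rfl⟩ := hj
  obtain ⟨β', rfl⟩ := hβ
  rw [ZMod.intCast_zmod_eq_zero_iff_dvd]
  exact ⟨4 * (k : ℤ) * β', by push_cast; ring⟩

/-- Two class secrets have the same line points at the parameters `≡ 0 (mod Q)`.
[cite: ChenQuantumLattice2024, §3.5.9 p. 35, eq. (12) p. 17] -/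
theorem ptB_eq_of_toQ_eq_zero {U : Finset (Fin (n + 1))} {bk b b' : Fin (n + 1) → ℤ}
    (hb : InClass n p₁ U bk b) (hb' : InClass n p₁ U bk b') (v' : Fin (n + 1) → ℤ) {j : ZP p₁ Q}
    (hj : toQ p₁ Q j = 0) : ptB n D p₁ Q b v' j = ptB n D p₁ Q b' v' j := by
  have hx : ((j.val : ℕ) : ZQ Q) = 0 := by
    rw [← hj, toQ, ZMod.castHom_apply, ZMod.cast_eq_val]
  have hQj : (Q : ℕ) ∣ j.val := (ZMod.natCast_eq_zero_iff _ _).1 hx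
  funext i
  by_cases hi : i ∈ U
  · simp only [ptB, Int.cast_add]
    rw [twoDsq_mul_eq_zero_of_dvd D p₁ Q hQj (hb.2 i hi), twoDsq_mul_eq_zero_of_dvd D p₁ Q hQj (hb'.2 i hi)]
  · simp only [ptB, hb.1 i hi, hb'.1 i hi]

/-- **The sub-line ket does not depend on the class secret.** [cite: ChenQuantumLattice2024, §3.5.9 p. 35, eq. (12) p. 17] -/
theorem InClass.sublineKet_eq {U : Finset (Fin (n + 1))} {bk b b' : Fin (n + 1) → ℤ}
    (hb : InClass n p₁ U bk b) (hb' : InClass n p₁ U bk b') (v' : Fin (n + 1) → ℤ) :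
    sublineKet n D p₁ Q b v' = sublineKet n D p₁ Q b' v' := by
  funext z
  unfold sublineKet lineKet
  refine Finset.sum_congr rfl fun j _ => ?_
  by_cases hj : toQ p₁ Q j = 0
  · rw [ptB_eq_of_toQ_eq_zero n D p₁ Q hb hb' v' hj]
  · simp only [if_neg hj, ite_self]

/-- **The members `t ≡ 0 (mod p₁)` of the chirp family resolve the sub-line ket**:
`Σ_{t ∈ ℤ_P} conj ψ_P(−(p₁t)²) · |φ_{b, v′−2D²(p₁t)·b}⟩ = P · sublineKet b v′` (odd `Q`).
[cite: ChenQuantumLattice2024, §3.5.9 p. 35; folklore] -/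
theorem sum_conj_chirp_p₁_smul_phi8bKet (hQ : Odd ((Q : ℕ+) : ℕ)) (b v' : Fin (n + 1) → ℤ) :
    ∑ t : ZP p₁ Q, (starRingEnd ℂ) (ZMod.stdAddChar (-((((p₁ : ℕ) : ZP p₁ Q) * t) ^ 2) : ZP p₁ Q) : ℂ)
        • phi8bKet n D p₁ Q b (lineShift n D b v' (-(((((p₁ : ℕ) : ZP p₁ Q) * t).val : ℕ) : ℤ)))
      = (((p₁ * Q : ℕ+) : ℕ) : ℂ) • sublineKet n D p₁ Q b v' := by
  simp_rw [phi8bKet_lineShift_negVal]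
  rw [sum_smul_lineKet]
  unfold sublineKet
  rw [smul_lineKet]
  congr 1
  funext j
  simp_rw [conj_chirp_mul_chirp_add]
  rw [← Finset.mul_sum]
  have hre : ∀ t : ZP p₁ Q, (ZMod.stdAddChar (((p₁ : ℕ) : ZP p₁ Q) * t * (-(2 * j))) : ℂ)
      = ZMod.stdAddChar (t * (((p₁ : ℕ) : ZP p₁ Q) * (-(2 * j)))) := by
    intro t; congr 1; ring
  simp_rw [hre]
  rw [AddChar.sum_mulShift _ (ZMod.isPrimitive_stdAddChar _), ZMod.card]
  by_cases hj : toQ p₁ Q j = 0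
  · have h0 : ((p₁ : ℕ) : ZP p₁ Q) * (-(2 * j)) = 0 :=
      (p₁_mul_eq_zero_iff p₁ Q _).2 ((toQ_neg_two_mul_eq_zero_iff p₁ Q hQ j).2 hj)
    rw [if_pos h0, if_pos hj, mul_comm]
  · have h0 : ((p₁ : ℕ) : ZP p₁ Q) * (-(2 * j)) ≠ 0 := fun h =>
      hj ((toQ_neg_two_mul_eq_zero_iff p₁ Q hQ j).1 ((p₁_mul_eq_zero_iff p₁ Q _).1 h))
    rw [if_neg h0, if_neg hj, Nat.cast_zero, mul_zero, mul_zero]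

/-- **Expansion of `E(sublineKet)` in the chirp family.** If `E|φ_{b,v′−2D²(p₁t)·b}⟩ = λ(t)·|φ_{b,v′−2D²(p₁t)·b}⟩`
for all `t ∈ ℤ_P`, then `P·E(sublineKet b v′) = Σ_j ψ_P(−j²)·λ̂(p₁·(−2j)) |2D²j·b + v′⟩`.
[cite: ChenQuantumLattice2024, §3.5.9 p. 35; folklore] -/
theorem nd_sublineExpansion (hQ : Odd ((Q : ℕ+) : ℕ)) (b v' : Fin (n + 1) → ℤ)
    (E : Ket (n + 1) ((D * D * (p₁ * Q) : ℕ+) : ℕ) →ₗ[ℂ] Ket (n + 1) ((D * D * (p₁ * Q) : ℕ+) : ℕ))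
    (l : ZP p₁ Q → ℂ)
    (hE : ∀ t : ZP p₁ Q,
      E (phi8bKet n D p₁ Q b (lineShift n D b v' (-(((((p₁ : ℕ) : ZP p₁ Q) * t).val : ℕ) : ℤ))))
        = l t • phi8bKet n D p₁ Q b (lineShift n D b v' (-(((((p₁ : ℕ) : ZP p₁ Q) * t).val : ℕ) : ℤ)))) :
    (((p₁ * Q : ℕ+) : ℕ) : ℂ) • E (sublineKet n D p₁ Q b v')
      = lineKet (ptB n D p₁ Q b v')
          (fun j => (ZMod.stdAddChar (-(j ^ 2) : ZP p₁ Q) : ℂ)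
            * profileDFT p₁ Q l (((p₁ : ℕ) : ZP p₁ Q) * (-(2 * j)))) := by
  rw [← map_smul, ← sum_conj_chirp_p₁_smul_phi8bKet n D p₁ Q hQ b v', map_sum]
  have hE' : ∀ t : ZP p₁ Q,
      E ((starRingEnd ℂ) (ZMod.stdAddChar (-((((p₁ : ℕ) : ZP p₁ Q) * t) ^ 2) : ZP p₁ Q) : ℂ)
          • phi8bKet n D p₁ Q b (lineShift n D b v' (-(((((p₁ : ℕ) : ZP p₁ Q) * t).val : ℕ) : ℤ))))
        = ((starRingEnd ℂ) (ZMod.stdAddChar (-((((p₁ : ℕ) : ZP p₁ Q) * t) ^ 2) : ZP p₁ Q) : ℂ) * l t)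
          • lineKet (ptB n D p₁ Q b v')
              (fun j => (ZMod.stdAddChar (-((j + ((p₁ : ℕ) : ZP p₁ Q) * t) ^ 2) : ZP p₁ Q) : ℂ)) := by
    intro t
    rw [map_smul, hE t, smul_smul, phi8bKet_lineShift_negVal]
  simp_rw [hE']
  rw [sum_smul_lineKet]
  congr 1
  funext j
  unfold profileDFT
  rw [Finset.mul_sum]
  refine Finset.sum_congr rfl fun t _ => ?_
  have hre : (ZMod.stdAddChar (t * (((p₁ : ℕ) : ZP p₁ Q) * (-(2 * j)))) : ℂ)
      = ZMod.stdAddChar (((p₁ : ℕ) : ZP p₁ Q) * t * (-(2 * j))) := by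
    congr 1; ring
  calc (starRingEnd ℂ) (ZMod.stdAddChar (-((((p₁ : ℕ) : ZP p₁ Q) * t) ^ 2) : ZP p₁ Q) : ℂ) * l t
          * (ZMod.stdAddChar (-((j + ((p₁ : ℕ) : ZP p₁ Q) * t) ^ 2) : ZP p₁ Q) : ℂ)
      = l t * ((starRingEnd ℂ) (ZMod.stdAddChar (-((((p₁ : ℕ) : ZP p₁ Q) * t) ^ 2) : ZP p₁ Q) : ℂ)
          * (ZMod.stdAddChar (-((j + ((p₁ : ℕ) : ZP p₁ Q) * t) ^ 2) : ZP p₁ Q) : ℂ)) := by ring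
    _ = l t * ((ZMod.stdAddChar (-(j ^ 2) : ZP p₁ Q) : ℂ)
          * (ZMod.stdAddChar (((p₁ : ℕ) : ZP p₁ Q) * t * (-(2 * j)) : ZP p₁ Q) : ℂ)) := by
        rw [conj_chirp_mul_chirp_add]
    _ = (ZMod.stdAddChar (-(j ^ 2) : ZP p₁ Q) : ℂ)
          * (l t * (ZMod.stdAddChar (t * (((p₁ : ℕ) : ZP p₁ Q) * (-(2 * j)))) : ℂ)) := by
        rw [hre]; ring

/-! ### The knowable coset of an offset and coset-non-demolition operations -/

/-- `w` lies in the KNOWABLE COSET of `v′`: `w ≡ v′ + d(a,c) (mod N)` for a class shift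
`d(a,c) = D²p₁(a·bk + c·𝟙_U)` — by `offset_indistinguishable_iff`, exactly the offsets that share every
line invariant and the Step-8 datum with `v′`. [cite: ChenQuantumLattice2024, Claim 3.14 pp. 33–34, §3.5.9 p. 35] -/
def SameCoset (U : Finset (Fin (n + 1))) (bk : Fin (n + 1) → ℤ) (v' w : Fin (n + 1) → ℤ) : Prop :=
  ∃ (a : ZQ Q) (c : Fin (n + 1) → ZQ Q),
    ∀ i, ((w i : ℤ) : ZN D p₁ Q) = ((v' i + classShift n D p₁ Q U bk a c i : ℤ) : ZN D p₁ Q)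

/-- `E` is COSET-NON-DEMOLITION at `v′`: non-demolition on the line ket `|φ_{b,w}⟩` of every class
secret `b` and every offset `w` of the knowable coset of `v′` — the state-preservation guarantee
restricted to the instances consistent with what Steps 1–8 reveal (REFEREE N-12.4).
[cite: ChenQuantumLattice2024, Claim 3.14 pp. 33–34, §3.5.9 p. 35, eq. (12) p. 17] -/
def IsCosetND (U : Finset (Fin (n + 1))) (bk : Fin (n + 1) → ℤ) (v' : Fin (n + 1) → ℤ)
    (E : Ket (n + 1) ((D * D * (p₁ * Q) : ℕ+) : ℕ) →ₗ[ℂ] Ket (n + 1) ((D * D * (p₁ * Q) : ℕ+) : ℕ)) :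
    Prop :=
  ∀ b, InClass n p₁ U bk b → ∀ w : Fin (n + 1) → ℤ, SameCoset n D p₁ Q U bk v' w →
    IsNonDemolition E (phi8bKet n D p₁ Q b w)

variable {n D p₁ Q}
variable {U : Finset (Fin (n + 1))} {bk : Fin (n + 1) → ℤ}

/-- A class-non-demolition operation is coset-non-demolition at every offset. [folklore] -/
theorem IsClassND.isCosetND
    {E : Ket (n + 1) ((D * D * (p₁ * Q) : ℕ+) : ℕ) →ₗ[ℂ] Ket (n + 1) ((D * D * (p₁ * Q) : ℕ+) : ℕ)}
    (hE : IsClassND n D p₁ Q U bk E) (v' : Fin (n + 1) → ℤ) : IsCosetND n D p₁ Q U bk v' E :=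
  fun b hb w _ => hE b hb w

/-- The casts of the class shifts form an additive family: `d(a,c) + d(a′,c′) ≡ d(a+a′, c+c′) (mod N)`.
[cite: ChenQuantumLattice2024, Claim 3.14 pp. 33–34] -/
theorem classShift_add_cast (a a' : ZQ Q) (c c' : Fin (n + 1) → ZQ Q) (i : Fin (n + 1)) :
    ((classShift n D p₁ Q U bk a c i : ℤ) : ZN D p₁ Q) + ((classShift n D p₁ Q U bk a' c' i : ℤ) : ZN D p₁ Q)
      = ((classShift n D p₁ Q U bk (a + a') (c + c') i : ℤ) : ZN D p₁ Q) := by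
  rw [← Int.cast_add]
  simp only [classShift]
  rw [← mul_add]
  refine Dsq_p₁_mul_eq_of_modEq D p₁ Q ((ZMod.intCast_eq_intCast_iff _ _ _).1 ?_)
  by_cases hi : i ∈ U
  · simp only [classTail, if_pos hi, Pi.add_apply]
    push_cast
    rw [ZMod.natCast_zmod_val, ZMod.natCast_zmod_val, ZMod.natCast_zmod_val, ZMod.natCast_zmod_val,
      ZMod.natCast_zmod_val, ZMod.natCast_zmod_val]
    ring
  · simp only [classTail, if_neg hi]
    push_cast
    rw [ZMod.natCast_zmod_val, ZMod.natCast_zmod_val, ZMod.natCast_zmod_val]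
    ring

/-- The knowable coset contains `v′`. [folklore] -/
theorem sameCoset_refl (v' : Fin (n + 1) → ℤ) : SameCoset n D p₁ Q U bk v' v' :=
  ⟨0, 0, fun i => by simp [classShift, classTail]⟩

/-- `SameCoset` sees the second offset only mod `N`. [folklore] -/
theorem SameCoset.congr {v' w w' : Fin (n + 1) → ℤ} (h : SameCoset n D p₁ Q U bk v' w)
    (hw : ∀ i, ((w i : ℤ) : ZN D p₁ Q) = ((w' i : ℤ) : ZN D p₁ Q)) : SameCoset n D p₁ Q U bk v' w' := by
  obtain ⟨a, c, hac⟩ := h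
  exact ⟨a, c, fun i => (hw i).symm.trans (hac i)⟩

/-- The knowable cosets are transitive (the class shifts are closed under addition mod `N`). [folklore] -/
theorem SameCoset.trans {v' w w' : Fin (n + 1) → ℤ} (h₁ : SameCoset n D p₁ Q U bk v' w)
    (h₂ : SameCoset n D p₁ Q U bk w w') : SameCoset n D p₁ Q U bk v' w' := by
  obtain ⟨a, c, hac⟩ := h₁
  obtain ⟨a', c', hac'⟩ := h₂
  refine ⟨a + a', c + c', fun i => ?_⟩
  rw [hac' i, Int.cast_add, hac i, Int.cast_add, Int.cast_add, add_assoc, classShift_add_cast]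

/-- **Moving a multiple of `p₁` steps along the line of a class secret stays in the knowable coset**:
`v′ + 2D²(p₁m)·b ≡ v′ + d(2m, 2m(b − bk)·𝟙_U)`. [cite: ChenQuantumLattice2024, §3.5.9 p. 35, eq. (12) p. 17] -/
theorem sameCoset_lineShift_p₁_mul {b : Fin (n + 1) → ℤ} (hb : InClass n p₁ U bk b)
    (v' : Fin (n + 1) → ℤ) (m : ℤ) :
    SameCoset n D p₁ Q U bk v' (lineShift n D b v' (((p₁ : ℕ) : ℤ) * m)) := by
  refine ⟨((2 * m : ℤ) : ZQ Q),
    fun i => ((2 * m * b i : ℤ) : ZQ Q) - ((2 * m : ℤ) : ZQ Q) * ((bk i : ℤ) : ZQ Q), fun i => ?_⟩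
  simp only [lineShift, classShift, Int.cast_add]
  congr 1
  rw [show 2 * ((D : ℕ) : ℤ) ^ 2 * (((p₁ : ℕ) : ℤ) * m) * b i
      = ((D : ℕ) : ℤ) ^ 2 * ((p₁ : ℕ) : ℤ) * (2 * m * b i) by ring]
  refine Dsq_p₁_mul_eq_of_modEq D p₁ Q ((ZMod.intCast_eq_intCast_iff _ _ _).1 ?_)
  by_cases hi : i ∈ U
  · simp only [classTail, if_pos hi]
    push_cast
    rw [ZMod.natCast_zmod_val, ZMod.natCast_zmod_val]
    ring
  · simp only [classTail, if_neg hi, hb.1 i hi]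
    push_cast
    rw [ZMod.natCast_zmod_val]
    ring

/-- Adding multiples of `D²p₁` on unknown coordinates stays in the knowable coset.
[cite: ChenQuantumLattice2024, Claim 3.14 pp. 33–34, eq. (12) p. 17] -/
theorem sameCoset_add_on (v' r : Fin (n + 1) → ℤ) {S : Finset (Fin (n + 1))} (hS : S ⊆ U) :
    SameCoset n D p₁ Q U bk v'
      (fun i => v' i + if i ∈ S then ((D : ℕ) : ℤ) ^ 2 * ((p₁ : ℕ) : ℤ) * r i else 0) := by
  classical
  refine ⟨0, fun i => if i ∈ S then ((r i : ℤ) : ZQ Q) else 0, fun i => ?_⟩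
  simp only [Int.cast_add]
  congr 1
  by_cases hiS : i ∈ S
  · have hiU : i ∈ U := hS hiS
    simp only [if_pos hiS, classShift, classTail, if_pos hiU, ZMod.val_zero, Nat.cast_zero, zero_mul,
      zero_add]
    refine Dsq_p₁_mul_eq_of_modEq D p₁ Q ?_
    rw [ZMod.val_intCast]
    exact (Int.mod_modEq _ _).symm
  · simp [if_neg hiS, classShift, classTail]

section CosetND

variable {E : Ket (n + 1) ((D * D * (p₁ * Q) : ℕ+) : ℕ) →ₗ[ℂ] Ket (n + 1) ((D * D * (p₁ * Q) : ℕ+) : ℕ)}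
variable {v' : Fin (n + 1) → ℤ}

/-- Coset-non-demolition is a property of the coset, not of its representative. [folklore] -/
theorem IsCosetND.of_sameCoset (hE : IsCosetND n D p₁ Q U bk v' E) {w : Fin (n + 1) → ℤ}
    (hw : SameCoset n D p₁ Q U bk v' w) : IsCosetND n D p₁ Q U bk w E :=
  fun b hb w' hw' => hE b hb w' (hw.trans hw')

/-- `(p₁t).val ≡ p₁·t.val (mod P)`. [folklore] -/
theorem val_p₁_mul_modEq (t : ZP p₁ Q) :
    (((((p₁ : ℕ) : ZP p₁ Q) * t).val : ℕ) : ℤ) ≡ ((p₁ : ℕ) : ℤ) * ((t.val : ℕ) : ℤ)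
      [ZMOD (((p₁ * Q : ℕ+) : ℕ) : ℤ)] := by
  have h : ((p₁ : ℕ) : ZP p₁ Q) * t = ((((p₁ : ℕ) * t.val : ℕ)) : ZP p₁ Q) := by
    rw [Nat.cast_mul, ZMod.natCast_zmod_val]
  rw [h, ZMod.val_natCast, Int.natCast_mod, Nat.cast_mul]
  exact Int.mod_modEq _ _

/-- A coset-non-demolition operation is non-demolition on the members `t ≡ 0 (mod p₁)` of the chirp
family through `v′` of every class secret. [cite: ChenQuantumLattice2024, §3.5.9 p. 35, eq. (12) p. 17] -/
theorem IsCosetND.nd_lineShift_p₁ (hE : IsCosetND n D p₁ Q U bk v' E) {b : Fin (n + 1) → ℤ}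
    (hb : InClass n p₁ U bk b) (t : ZP p₁ Q) :
    IsNonDemolition E
      (phi8bKet n D p₁ Q b (lineShift n D b v' (-(((((p₁ : ℕ) : ZP p₁ Q) * t).val : ℕ) : ℤ)))) := by
  refine hE b hb _ ((sameCoset_lineShift_p₁_mul hb v' (-((t.val : ℕ) : ℤ))).congr fun i =>
    lineShift_cast_eq_of_modEq n D p₁ Q b v' ?_ i)
  rw [mul_neg]
  exact (val_p₁_mul_modEq t).symm.neg

end CosetND

section CosetMain

variable {E : Ket (n + 1) ((D * D * (p₁ * Q) : ℕ+) : ℕ) →ₗ[ℂ] Ket (n + 1) ((D * D * (p₁ * Q) : ℕ+) : ℕ)}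
variable {v' : Fin (n + 1) → ℤ}

/-- The eigenvalues along the sub-line: `λ^Q_{E,b,v′}(t) = λ_{E,b,v′}(p₁t) = ndValue E b (v′ − 2D²(p₁t)·b)`,
a `Q`-periodic function on `ℤ_P`. [folklore] -/
noncomputable def sublineProfile
    (E : Ket (n + 1) ((D * D * (p₁ * Q) : ℕ+) : ℕ) →ₗ[ℂ] Ket (n + 1) ((D * D * (p₁ * Q) : ℕ+) : ℕ))
    (b v' : Fin (n + 1) → ℤ) (t : ZP p₁ Q) : ℂ :=
  evProfile n D p₁ Q E b v' (((p₁ : ℕ) : ZP p₁ Q) * t)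

/-- `λ^Q(0)` is the eigenvalue at `v′`. [folklore] -/
theorem sublineProfile_zero
    (E : Ket (n + 1) ((D * D * (p₁ * Q) : ℕ+) : ℕ) →ₗ[ℂ] Ket (n + 1) ((D * D * (p₁ * Q) : ℕ+) : ℕ))
    (b v' : Fin (n + 1) → ℤ) : sublineProfile E b v' 0 = ndValue n D p₁ Q E b v' := by
  unfold sublineProfile
  rw [mul_zero, evProfile_zero]

/-- `λ^Q` has period `Q`. [folklore] -/
theorem sublineProfile_periodic
    (E : Ket (n + 1) ((D * D * (p₁ * Q) : ℕ+) : ℕ) →ₗ[ℂ] Ket (n + 1) ((D * D * (p₁ * Q) : ℕ+) : ℕ))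
    (b v' : Fin (n + 1) → ℤ) (t : ZP p₁ Q) :
    sublineProfile E b v' (t + ((Q : ℕ) : ZP p₁ Q)) = sublineProfile E b v' t := by
  unfold sublineProfile
  rw [mul_add, p₁_mul_Q_eq_zero, add_zero]

/-- `λ̂^Q` vanishes off `p₁ℤ_P`. [folklore] -/
theorem profileDFT_sublineProfile_eq_zero_of_Q_mul_ne
    (E : Ket (n + 1) ((D * D * (p₁ * Q) : ℕ+) : ℕ) →ₗ[ℂ] Ket (n + 1) ((D * D * (p₁ * Q) : ℕ+) : ℕ))
    (b v' : Fin (n + 1) → ℤ) {s : ZP p₁ Q} (hs : ((Q : ℕ) : ZP p₁ Q) * s ≠ 0) :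
    profileDFT p₁ Q (sublineProfile E b v') s = 0 :=
  profileDFT_eq_zero_of_periodic p₁ Q _ _ (sublineProfile_periodic E b v') hs

/-- Under `IsCosetND` the expansion of `P·E(sublineKet)` runs along the line of any class secret `b`,
with the sub-line eigenvalue profile. [cite: ChenQuantumLattice2024, §3.5.9 p. 35; folklore] -/
theorem IsCosetND.sublineExpansion (hE : IsCosetND n D p₁ Q U bk v' E) (hP : Odd ((p₁ * Q : ℕ+) : ℕ))
    (hQ : Odd ((Q : ℕ+) : ℕ)) (hU : (0 : Fin (n + 1)) ∉ U) (hbk0 : bk 0 = -1) {b : Fin (n + 1) → ℤ}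
    (hb : InClass n p₁ U bk b) :
    (((p₁ * Q : ℕ+) : ℕ) : ℂ) • E (sublineKet n D p₁ Q b v')
      = lineKet (ptB n D p₁ Q b v') (fun j => (ZMod.stdAddChar (-(j ^ 2) : ZP p₁ Q) : ℂ)
          * profileDFT p₁ Q (sublineProfile E b v') (((p₁ : ℕ) : ZP p₁ Q) * (-(2 * j)))) :=
  nd_sublineExpansion n D p₁ Q hQ b v' E _
    (fun t => (hE.nd_lineShift_p₁ hb t).eq_smul n D p₁ Q hP (InClass.apply_zero n p₁ hU hbk0 hb))

/-- **Two class secrets expand the same vector** `P·E(sublineKet)` (the sub-line ket is secret-free):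
`F_b(i) = [2D²i·b + v′ ≡ 2D²i·b′ + v′]·F_{b′}(i)` for `F_b(i) = ψ_P(−i²)·λ̂^Q_b(p₁(−2i))`.
[cite: ChenQuantumLattice2024, §3.5.9 p. 35; folklore] -/
theorem IsCosetND.sublineCoeff_eq_ite (hE : IsCosetND n D p₁ Q U bk v' E) (hP : Odd ((p₁ * Q : ℕ+) : ℕ))
    (hQ : Odd ((Q : ℕ+) : ℕ)) (hU : (0 : Fin (n + 1)) ∉ U) (hbk0 : bk 0 = -1) {b b' : Fin (n + 1) → ℤ}
    (hb : InClass n p₁ U bk b) (hb' : InClass n p₁ U bk b') (i : ZP p₁ Q) :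
    (ZMod.stdAddChar (-(i ^ 2) : ZP p₁ Q) : ℂ)
        * profileDFT p₁ Q (sublineProfile E b v') (((p₁ : ℕ) : ZP p₁ Q) * (-(2 * i)))
      = if ptB n D p₁ Q b v' i = ptB n D p₁ Q b' v' i
        then (ZMod.stdAddChar (-(i ^ 2) : ZP p₁ Q) : ℂ)
          * profileDFT p₁ Q (sublineProfile E b' v') (((p₁ : ℕ) : ZP p₁ Q) * (-(2 * i)))
        else 0 := by
  have hb0 := InClass.apply_zero n p₁ hU hbk0 hb
  have hb0' := InClass.apply_zero n p₁ hU hbk0 hb'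
  have e := ((hE.sublineExpansion hP hQ hU hbk0 hb).symm.trans
    (by rw [hb.sublineKet_eq n D p₁ Q hb' v'])).trans (hE.sublineExpansion hP hQ hU hbk0 hb')
  have ev := congrFun e (ptB n D p₁ Q b v' i)
  rw [lineKet_apply_pt (ptB_injective n D p₁ Q b v' hP hb0)] at ev
  rw [ev]
  by_cases hmeet : ptB n D p₁ Q b v' i = ptB n D p₁ Q b' v' i
  · rw [if_pos hmeet, hmeet, lineKet_apply_pt (ptB_injective n D p₁ Q b' v' hP hb0')]
  · rw [if_neg hmeet]
    refine lineKet_apply_of_ne _ _ fun j hj => ?_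
    have hij : i = j := eq_of_ptB_apply_zero_eq n D p₁ Q hP hb0 hb0' v' (congrFun hj 0)
    subst hij
    exact hmeet hj

/-- The Fourier transform of the sub-line eigenvalue profile does not depend on the class secret.
[cite: ChenQuantumLattice2024, §3.5.9 p. 35; folklore] -/
theorem IsCosetND.profileDFT_sublineProfile_indep (hE : IsCosetND n D p₁ Q U bk v' E)
    (hP : Odd ((p₁ * Q : ℕ+) : ℕ)) (hQ : Odd ((Q : ℕ+) : ℕ)) (hU : (0 : Fin (n + 1)) ∉ U)
    (hbk0 : bk 0 = -1) {b b' : Fin (n + 1) → ℤ} (hb : InClass n p₁ U bk b) (hb' : InClass n p₁ U bk b')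
    (s : ZP p₁ Q) :
    profileDFT p₁ Q (sublineProfile E b v') s = profileDFT p₁ Q (sublineProfile E b' v') s := by
  by_cases hQs : ((Q : ℕ) : ZP p₁ Q) * s = 0
  · obtain ⟨y, rfl⟩ := exists_eq_p₁_mul_of_Q_mul_eq_zero p₁ Q hQs
    obtain ⟨w, hw⟩ := (Literature.NumberTheory.GaussSums.isUnit_two_zmod_of_odd _ hP).exists_right_inv
    set i : ZP p₁ Q := -(y * w) with hi_def
    have hs : -(2 * i) = y := by rw [hi_def]; linear_combination y * hw
    have h1 := hE.sublineCoeff_eq_ite hP hQ hU hbk0 hb hb' i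
    have h2 := hE.sublineCoeff_eq_ite hP hQ hU hbk0 hb' hb i
    have hF : (ZMod.stdAddChar (-(i ^ 2) : ZP p₁ Q) : ℂ)
          * profileDFT p₁ Q (sublineProfile E b v') (((p₁ : ℕ) : ZP p₁ Q) * (-(2 * i)))
        = (ZMod.stdAddChar (-(i ^ 2) : ZP p₁ Q) : ℂ)
          * profileDFT p₁ Q (sublineProfile E b' v') (((p₁ : ℕ) : ZP p₁ Q) * (-(2 * i))) := by
      by_cases hmeet : ptB n D p₁ Q b v' i = ptB n D p₁ Q b' v' i
      · rw [h1, if_pos hmeet]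
      · rw [h1, if_neg hmeet, h2, if_neg (Ne.symm hmeet)]
    rw [← hs]
    exact mul_left_cancel₀ (chirp_ne_zero p₁ Q i) hF
  · rw [profileDFT_sublineProfile_eq_zero_of_Q_mul_ne E b v' hQs,
      profileDFT_sublineProfile_eq_zero_of_Q_mul_ne E b' v' hQs]

/-- The sub-line eigenvalue profile does not depend on the class secret.
[cite: ChenQuantumLattice2024, §3.5.9 p. 35; folklore] -/
theorem IsCosetND.sublineProfile_indep (hE : IsCosetND n D p₁ Q U bk v' E) (hP : Odd ((p₁ * Q : ℕ+) : ℕ))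
    (hQ : Odd ((Q : ℕ+) : ℕ)) (hU : (0 : Fin (n + 1)) ∉ U) (hbk0 : bk 0 = -1) {b b' : Fin (n + 1) → ℤ}
    (hb : InClass n p₁ U bk b) (hb' : InClass n p₁ U bk b') (t : ZP p₁ Q) :
    sublineProfile E b v' t = sublineProfile E b' v' t := by
  have hPne : (((p₁ * Q : ℕ+) : ℕ) : ℂ) ≠ 0 := Nat.cast_ne_zero.2 (PNat.ne_zero _)
  have h := profileDFT_inversion p₁ Q (sublineProfile E b v') t
  have h' := profileDFT_inversion p₁ Q (sublineProfile E b' v') t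
  simp_rw [hE.profileDFT_sublineProfile_indep hP hQ hU hbk0 hb hb'] at h
  exact mul_left_cancel₀ hPne (h.symm.trans h')

/-- **Secret independence of the eigenvalue under the coset-restricted hypothesis** (odd `P`, odd `Q`,
`0 ∉ U`, `bk₀ = −1`). [cite: ChenQuantumLattice2024, §3.5.9 p. 35, eq. (12) p. 17] -/
theorem IsCosetND.ndValue_secret_indep (hE : IsCosetND n D p₁ Q U bk v' E) (hP : Odd ((p₁ * Q : ℕ+) : ℕ))
    (hQ : Odd ((Q : ℕ+) : ℕ)) (hU : (0 : Fin (n + 1)) ∉ U) (hbk0 : bk 0 = -1) {b b' : Fin (n + 1) → ℤ}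
    (hb : InClass n p₁ U bk b) (hb' : InClass n p₁ U bk b') :
    ndValue n D p₁ Q E b v' = ndValue n D p₁ Q E b' v' := by
  rw [← sublineProfile_zero E b v', ← sublineProfile_zero E b' v']
  exact hE.sublineProfile_indep hP hQ hU hbk0 hb hb' 0

/-- `λ̂^Q_b` vanishes off `0` (compare `b` with its bump at some `i₀ ∈ U`: off `p₁ℤ_P` by periodicity,
on `p₁ℤ_P ∖ 0` because the two lines through `v′` meet only at parameters `≡ 0 (mod Q)`).
[cite: ChenQuantumLattice2024, §3.5.9 p. 35, eq. (12) p. 17] -/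
theorem IsCosetND.profileDFT_sublineProfile_eq_zero (hE : IsCosetND n D p₁ Q U bk v' E)
    (hP : Odd ((p₁ * Q : ℕ+) : ℕ)) (hQ : Odd ((Q : ℕ+) : ℕ)) (hU : (0 : Fin (n + 1)) ∉ U)
    (hbk0 : bk 0 = -1) {b : Fin (n + 1) → ℤ} (hb : InClass n p₁ U bk b) {i₀ : Fin (n + 1)}
    (hi₀ : i₀ ∈ U) {s : ZP p₁ Q} (hs : s ≠ 0) :
    profileDFT p₁ Q (sublineProfile E b v') s = 0 := by
  by_cases hQs : ((Q : ℕ) : ZP p₁ Q) * s = 0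
  · obtain ⟨y, rfl⟩ := exists_eq_p₁_mul_of_Q_mul_eq_zero p₁ Q hQs
    obtain ⟨w, hw⟩ := (Literature.NumberTheory.GaussSums.isUnit_two_zmod_of_odd _ hP).exists_right_inv
    set i : ZP p₁ Q := -(y * w) with hi_def
    have hsi : -(2 * i) = y := by rw [hi_def]; linear_combination y * hw
    have hti : toQ p₁ Q i ≠ 0 := by
      intro h0
      apply hs
      rw [← hsi]
      exact (p₁_mul_eq_zero_iff p₁ Q _).2 ((toQ_neg_two_mul_eq_zero_iff p₁ Q hQ i).2 h0)
    have h1 := hE.sublineCoeff_eq_ite hP hQ hU hbk0 hb (hb.bump hi₀) i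
    have hmeet : ptB n D p₁ Q b v' i ≠ ptB n D p₁ Q (bump (p₁ := p₁) b i₀) v' i :=
      fun h => hti (toQ_eq_zero_of_ptB_eq_ptB_bump hQ v' h)
    rw [if_neg hmeet] at h1
    rw [← hsi]
    exact (mul_eq_zero.1 h1).resolve_left (chirp_ne_zero p₁ Q i)
  · exact profileDFT_sublineProfile_eq_zero_of_Q_mul_ne E b v' hQs

/-- The sub-line eigenvalue profile is constant. [cite: ChenQuantumLattice2024, §3.5.9 p. 35, eq. (12) p. 17] -/
theorem IsCosetND.sublineProfile_const (hE : IsCosetND n D p₁ Q U bk v' E) (hP : Odd ((p₁ * Q : ℕ+) : ℕ))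
    (hQ : Odd ((Q : ℕ+) : ℕ)) (hU : (0 : Fin (n + 1)) ∉ U) (hbk0 : bk 0 = -1) {b : Fin (n + 1) → ℤ}
    (hb : InClass n p₁ U bk b) {i₀ : Fin (n + 1)} (hi₀ : i₀ ∈ U) (k : ZP p₁ Q) :
    sublineProfile E b v' k = sublineProfile E b v' 0 := by
  have hPne : (((p₁ * Q : ℕ+) : ℕ) : ℂ) ≠ 0 := Nat.cast_ne_zero.2 (PNat.ne_zero _)
  have h := profileDFT_inversion p₁ Q (sublineProfile E b v') k
  have h' := profileDFT_inversion p₁ Q (sublineProfile E b v') 0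
  have hterms : ∀ s : ZP p₁ Q,
      profileDFT p₁ Q (sublineProfile E b v') s * (ZMod.stdAddChar (-(k * s)) : ℂ)
        = profileDFT p₁ Q (sublineProfile E b v') s * (ZMod.stdAddChar (-(0 * s)) : ℂ) := by
    intro s
    by_cases hs : s = 0
    · rw [hs, mul_zero, mul_zero]
    · rw [hE.profileDFT_sublineProfile_eq_zero hP hQ hU hbk0 hb hi₀ hs, zero_mul, zero_mul]
  simp_rw [hterms] at h
  exact mul_left_cancel₀ hPne (h.symm.trans h')

/-- **Line periodicity under the coset-restricted hypothesis**: the offset may move any multiple of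
`p₁` steps along the line (odd `P`, odd `Q`, `0 ∉ U`, `bk₀ = −1`, some `i₀ ∈ U`).
[cite: ChenQuantumLattice2024, §3.5.9 p. 35, eq. (12) p. 17] -/
theorem IsCosetND.ndValue_lineShift_p₁_mul (hE : IsCosetND n D p₁ Q U bk v' E)
    (hP : Odd ((p₁ * Q : ℕ+) : ℕ)) (hQ : Odd ((Q : ℕ+) : ℕ)) (hU : (0 : Fin (n + 1)) ∉ U)
    (hbk0 : bk 0 = -1) {b : Fin (n + 1) → ℤ} (hb : InClass n p₁ U bk b) {i₀ : Fin (n + 1)}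
    (hi₀ : i₀ ∈ U) (m : ℤ) :
    ndValue n D p₁ Q E b (lineShift n D b v' (((p₁ : ℕ) : ℤ) * m)) = ndValue n D p₁ Q E b v' := by
  have h := hE.sublineProfile_const hP hQ hU hbk0 hb hi₀ (((-m : ℤ)) : ZP p₁ Q)
  rw [sublineProfile_zero] at h
  rw [← h]
  unfold sublineProfile
  rw [show ((p₁ : ℕ) : ZP p₁ Q) * (((-m : ℤ)) : ZP p₁ Q) = (((-(((p₁ : ℕ) : ℤ) * m) : ℤ)) : ZP p₁ Q) by
    push_cast; ring, evProfile_intCast, neg_neg]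

/-- **One unknown coordinate of the offset may move by any multiple of `D²p₁`** under the
coset-restricted hypothesis (odd `P`, odd `Q`, `gcd(p₁,Q) = 1`, `0 ∉ U`, `bk₀ = −1`, `i₀ ∈ U`): every
intermediate offset of the bump argument stays in the knowable coset.
[cite: ChenQuantumLattice2024, §3.5.9 p. 35, eq. (12) p. 17] -/
theorem IsCosetND.ndValue_add_single (hE : IsCosetND n D p₁ Q U bk v' E) (hP : Odd ((p₁ * Q : ℕ+) : ℕ))
    (hQ : Odd ((Q : ℕ+) : ℕ)) (hpQ : Nat.Coprime (p₁ : ℕ) (Q : ℕ)) (hU : (0 : Fin (n + 1)) ∉ U)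
    (hbk0 : bk 0 = -1) {b : Fin (n + 1) → ℤ} (hb : InClass n p₁ U bk b) {i₀ : Fin (n + 1)}
    (hi₀ : i₀ ∈ U) (r : ℤ) :
    ndValue n D p₁ Q E b (fun i => v' i + if i = i₀ then ((D : ℕ) : ℤ) ^ 2 * ((p₁ : ℕ) : ℤ) * r else 0)
      = ndValue n D p₁ Q E b v' := by
  -- choose `m` with `4p₁m ≡ r (mod Q)`
  obtain ⟨m, hm⟩ : ∃ m : ℤ, r ≡ 4 * (((p₁ : ℕ) : ℤ) * m) [ZMOD (((Q : ℕ+) : ℕ) : ℤ)] := by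
    have h4 : Nat.Coprime 4 (Q : ℕ) := by
      have h2 : Nat.Coprime 2 (Q : ℕ) := Nat.coprime_two_left.2 hQ
      simpa using h2.pow_left 2
    have hunit : IsUnit (((4 * (p₁ : ℕ) : ℕ)) : ZQ Q) :=
      (ZMod.isUnit_iff_coprime _ _).2 (Nat.Coprime.mul_left h4 hpQ)
    obtain ⟨u, hu⟩ := hunit.exists_right_inv
    obtain ⟨m, hm⟩ := ZMod.intCast_surjective (u * ((r : ℤ) : ZQ Q))
    refine ⟨m, ?_⟩
    have hu' : (4 : ZQ Q) * ((p₁ : ℕ) : ZQ Q) * u = 1 := by rw [← hu]; push_cast; ring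
    have h0 : (((4 * (((p₁ : ℕ) : ℤ) * m) - r : ℤ)) : ZQ Q) = 0 := by
      push_cast
      rw [hm]
      linear_combination ((r : ℤ) : ZQ Q) * hu'
    exact Int.modEq_iff_dvd.2 ((ZMod.intCast_zmod_eq_zero_iff_dvd _ _).1 h0)
  have hb' : InClass n p₁ U bk (bump (p₁ := p₁) b i₀) := hb.bump hi₀
  -- the intermediate offsets lie in the knowable coset of `v′`
  have hw₁ : SameCoset n D p₁ Q U bk v' (lineShift n D b v' (-(((p₁ : ℕ) : ℤ) * m))) := by
    rw [← mul_neg]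
    exact sameCoset_lineShift_p₁_mul hb v' (-m)
  have hw₂ : SameCoset n D p₁ Q U bk v'
      (lineShift n D (bump (p₁ := p₁) b i₀) (lineShift n D b v' (-(((p₁ : ℕ) : ℤ) * m)))
        (((p₁ : ℕ) : ℤ) * m)) :=
    hw₁.trans (sameCoset_lineShift_p₁_mul hb' _ m)
  have hcast : ∀ i,
      (((v' i + if i = i₀ then ((D : ℕ) : ℤ) ^ 2 * ((p₁ : ℕ) : ℤ) * r else 0 : ℤ)) : ZN D p₁ Q)
        = (((v' i + if i = i₀ then ((D : ℕ) : ℤ) ^ 2 * ((p₁ : ℕ) : ℤ) * (4 * (((p₁ : ℕ) : ℤ) * m)) else 0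
            : ℤ)) : ZN D p₁ Q) := by
    intro i
    by_cases h : i = i₀
    · rw [if_pos h, if_pos h, Int.cast_add, Int.cast_add, Dsq_p₁_mul_eq_of_modEq D p₁ Q hm]
    · rw [if_neg h, if_neg h]
  calc ndValue n D p₁ Q E b (fun i => v' i + if i = i₀ then ((D : ℕ) : ℤ) ^ 2 * ((p₁ : ℕ) : ℤ) * r else 0)
      = ndValue n D p₁ Q E b
          (lineShift n D (bump (p₁ := p₁) b i₀) (lineShift n D b v' (-(((p₁ : ℕ) : ℤ) * m)))
            (((p₁ : ℕ) : ℤ) * m)) := by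
        rw [lineShift_bump]
        exact ndValue_congr n D p₁ Q E b hcast
    _ = ndValue n D p₁ Q E (bump (p₁ := p₁) b i₀)
          (lineShift n D (bump (p₁ := p₁) b i₀) (lineShift n D b v' (-(((p₁ : ℕ) : ℤ) * m)))
            (((p₁ : ℕ) : ℤ) * m)) := (hE.of_sameCoset hw₂).ndValue_secret_indep hP hQ hU hbk0 hb hb'
    _ = ndValue n D p₁ Q E (bump (p₁ := p₁) b i₀) (lineShift n D b v' (-(((p₁ : ℕ) : ℤ) * m))) :=
        (hE.of_sameCoset hw₁).ndValue_lineShift_p₁_mul hP hQ hU hbk0 hb' hi₀ m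
    _ = ndValue n D p₁ Q E b (lineShift n D b v' (-(((p₁ : ℕ) : ℤ) * m))) :=
        ((hE.of_sameCoset hw₁).ndValue_secret_indep hP hQ hU hbk0 hb hb').symm
    _ = ndValue n D p₁ Q E b (lineShift n D b v' (((p₁ : ℕ) : ℤ) * (-m))) := by rw [mul_neg]
    _ = ndValue n D p₁ Q E b v' := hE.ndValue_lineShift_p₁_mul hP hQ hU hbk0 hb hi₀ (-m)

/-- The unknown coordinates of the offset may move by any multiples of `D²p₁` (coset-restricted
hypothesis). [cite: ChenQuantumLattice2024, §3.5.9 p. 35, eq. (12) p. 17] -/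
theorem IsCosetND.ndValue_add_on (hE : IsCosetND n D p₁ Q U bk v' E) (hP : Odd ((p₁ * Q : ℕ+) : ℕ))
    (hQ : Odd ((Q : ℕ+) : ℕ)) (hpQ : Nat.Coprime (p₁ : ℕ) (Q : ℕ)) (hU : (0 : Fin (n + 1)) ∉ U)
    (hbk0 : bk 0 = -1) {b : Fin (n + 1) → ℤ} (hb : InClass n p₁ U bk b) (r : Fin (n + 1) → ℤ)
    (S : Finset (Fin (n + 1))) (hS : S ⊆ U) :
    ndValue n D p₁ Q E b (fun i => v' i + if i ∈ S then ((D : ℕ) : ℤ) ^ 2 * ((p₁ : ℕ) : ℤ) * r i else 0)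
      = ndValue n D p₁ Q E b v' := by
  revert hS
  refine Finset.induction_on S ?_ ?_
  · intro _
    simp only [Finset.notMem_empty, if_false, add_zero]
  · intro j S hj ih hS
    have hjU : j ∈ U := hS (Finset.mem_insert_self j S)
    have hSU : S ⊆ U := fun i hi => hS (Finset.mem_insert_of_mem hi)
    have hsplit : (fun i => v' i + if i ∈ insert j S then ((D : ℕ) : ℤ) ^ 2 * ((p₁ : ℕ) : ℤ) * r i else 0)
        = fun i => (v' i + if i ∈ S then ((D : ℕ) : ℤ) ^ 2 * ((p₁ : ℕ) : ℤ) * r i else 0)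
            + if i = j then ((D : ℕ) : ℤ) ^ 2 * ((p₁ : ℕ) : ℤ) * r j else 0 := by
      funext i
      by_cases hij : i = j
      · subst hij
        simp [hj]
      · simp [Finset.mem_insert, hij]
    rw [hsplit, (hE.of_sameCoset (sameCoset_add_on v' r hSU)).ndValue_add_single hP hQ hpQ hU hbk0 hb
      hjU (r j), ih hSU]

/-- **Class-shift blindness under the coset-restricted hypothesis** (odd `P`, odd `Q`, `gcd(p₁,Q) = 1`,
`0 ∉ U ≠ ∅`, `bk₀ = −1`). [cite: ChenQuantumLattice2024, §3.5.9 p. 35, Claim 3.14 pp. 33–34, eq. (12) p. 17] -/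
theorem IsCosetND.ndValue_classShift (hE : IsCosetND n D p₁ Q U bk v' E) (hP : Odd ((p₁ * Q : ℕ+) : ℕ))
    (hQ : Odd ((Q : ℕ+) : ℕ)) (hpQ : Nat.Coprime (p₁ : ℕ) (Q : ℕ)) (hU : (0 : Fin (n + 1)) ∉ U)
    (hU' : U.Nonempty) (hbk0 : bk 0 = -1) {b : Fin (n + 1) → ℤ} (hb : InClass n p₁ U bk b)
    (a : ZQ Q) (c : Fin (n + 1) → ZQ Q) :
    ndValue n D p₁ Q E b (fun i => v' i + classShift n D p₁ Q U bk a c i) = ndValue n D p₁ Q E b v' := by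
  obtain ⟨i₀, hi₀⟩ := hU'
  -- `a ≡ 2m₀ (mod Q)`
  obtain ⟨m₀, hm₀⟩ : ∃ m₀ : ℤ, ((a.val : ℕ) : ℤ) ≡ 2 * m₀ [ZMOD (((Q : ℕ+) : ℕ) : ℤ)] := by
    obtain ⟨k, hk⟩ := id hQ
    have hk' : (((Q : ℕ+) : ℕ) : ℤ) = 2 * (k : ℤ) + 1 := by rw [hk]; push_cast; ring
    refine ⟨((a.val : ℕ) : ℤ) * ((k : ℤ) + 1), Int.modEq_iff_dvd.2 ⟨((a.val : ℕ) : ℤ), ?_⟩⟩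
    rw [hk']
    ring
  -- split the class shift into a move along the line and per-coordinate multiples of `D²p₁`
  let r : Fin (n + 1) → ℤ := fun i => ((a.val : ℕ) : ℤ) * bk i + ((classTail n Q U c i : ℕ) : ℤ) - 2 * m₀ * b i
  have hsplit : (fun i => v' i + classShift n D p₁ Q U bk a c i)
      = lineShift n D b (fun i => v' i + ((D : ℕ) : ℤ) ^ 2 * ((p₁ : ℕ) : ℤ) * r i) (((p₁ : ℕ) : ℤ) * m₀) := by
    funext i
    simp only [lineShift, classShift, r]
    ring
  have hoff : ∀ i, i ∉ U → r i ≡ 0 [ZMOD (((Q : ℕ+) : ℕ) : ℤ)] := by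
    intro i hi
    have e : r i = (((a.val : ℕ) : ℤ) - 2 * m₀) * bk i := by
      simp only [r, classTail, if_neg hi, hb.1 i hi]
      push_cast
      ring
    rw [e]
    have h := (hm₀.sub_right (2 * m₀)).mul_right (bk i)
    rwa [sub_self, zero_mul] at h
  have hcast : ∀ i, (((v' i + ((D : ℕ) : ℤ) ^ 2 * ((p₁ : ℕ) : ℤ) * r i : ℤ)) : ZN D p₁ Q)
      = (((v' i + if i ∈ U then ((D : ℕ) : ℤ) ^ 2 * ((p₁ : ℕ) : ℤ) * r i else 0 : ℤ)) : ZN D p₁ Q) := by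
    intro i
    by_cases hi : i ∈ U
    · rw [if_pos hi]
    · rw [if_neg hi, Int.cast_add, Int.cast_add, Dsq_p₁_mul_eq_of_modEq D p₁ Q (hoff i hi)]
      simp
  -- the intermediate base point `v′ + D²p₁·r` lies in the knowable coset
  have hw : SameCoset n D p₁ Q U bk v' (fun i => v' i + ((D : ℕ) : ℤ) ^ 2 * ((p₁ : ℕ) : ℤ) * r i) :=
    (sameCoset_add_on v' r (subset_refl U)).congr fun i => (hcast i).symm
  rw [hsplit, (hE.of_sameCoset hw).ndValue_lineShift_p₁_mul hP hQ hU hbk0 hb hi₀ m₀,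
    ndValue_congr n D p₁ Q E b (v' := fun i => v' i + ((D : ℕ) : ℤ) ^ 2 * ((p₁ : ℕ) : ℤ) * r i)
      (v'' := fun i => v' i + if i ∈ U then ((D : ℕ) : ℤ) ^ 2 * ((p₁ : ℕ) : ℤ) * r i else 0) hcast]
  exact hE.ndValue_add_on hP hQ hpQ hU hbk0 hb r U (subset_refl U)

/-- **N-12.4 settled: a coset-non-demolition operation is class-blind on its coset.**  For odd `P`,
odd `Q`, `gcd(p₁,Q) = 1`, `0 ∉ U ≠ ∅`, `bk₀ = −1`: if `E` is merely non-demolition on the line kets of the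
class secrets through the offsets CONSISTENT WITH WHAT THE ALGORITHM KNOWS about `v′` (its line
invariants and Step-8 datum), then its eigenvalue is the same on `|φ_{b,v′}⟩` and on `|φ_{b′,w}⟩` for
all class secrets `b, b′` and every offset `w` of that coset — the coset-restricted relaxation of the
class-non-demolition hypothesis buys nothing: the centre correction stays invisible.
[cite: ChenQuantumLattice2024, §3.5.9 pp. 34–38, Claim 3.14 pp. 33–34, eq. (12) p. 17] -/
theorem IsCosetND.ndValue_eq_of_sameCoset (hE : IsCosetND n D p₁ Q U bk v' E)
    (hP : Odd ((p₁ * Q : ℕ+) : ℕ)) (hQ : Odd ((Q : ℕ+) : ℕ)) (hpQ : Nat.Coprime (p₁ : ℕ) (Q : ℕ))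
    (hU : (0 : Fin (n + 1)) ∉ U) (hU' : U.Nonempty) (hbk0 : bk 0 = -1) {b b' : Fin (n + 1) → ℤ}
    (hb : InClass n p₁ U bk b) (hb' : InClass n p₁ U bk b') {w : Fin (n + 1) → ℤ}
    (hw : SameCoset n D p₁ Q U bk v' w) :
    ndValue n D p₁ Q E b' w = ndValue n D p₁ Q E b v' := by
  obtain ⟨a, c, hac⟩ := hw
  rw [ndValue_congr n D p₁ Q E b' (v'' := fun i => v' i + classShift n D p₁ Q U bk a c i) hac,
    hE.ndValue_classShift hP hQ hpQ hU hU' hbk0 hb' a c]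
  exact (hE.ndValue_secret_indep hP hQ hU hbk0 hb hb').symm

/-- The same, in the class-shift form of `IsClassND.ndValue_class_blind` (which it implies, the
hypothesis being weaker: `IsClassND.isCosetND`). [cite: ChenQuantumLattice2024, §3.5.9 pp. 34–38, Claim 3.14 pp. 33–34, eq. (12) p. 17] -/
theorem IsCosetND.ndValue_class_blind (hE : IsCosetND n D p₁ Q U bk v' E)
    (hP : Odd ((p₁ * Q : ℕ+) : ℕ)) (hQ : Odd ((Q : ℕ+) : ℕ)) (hpQ : Nat.Coprime (p₁ : ℕ) (Q : ℕ))
    (hU : (0 : Fin (n + 1)) ∉ U) (hU' : U.Nonempty) (hbk0 : bk 0 = -1) {b b' : Fin (n + 1) → ℤ}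
    (hb : InClass n p₁ U bk b) (hb' : InClass n p₁ U bk b') (a : ZQ Q) (c : Fin (n + 1) → ZQ Q) :
    ndValue n D p₁ Q E b v' = ndValue n D p₁ Q E b' (fun i => v' i + classShift n D p₁ Q U bk a c i) :=
  (hE.ndValue_eq_of_sameCoset hP hQ hpQ hU hU' hbk0 hb hb' ⟨a, c, fun _ => rfl⟩).symm

/-- **One eigenvalue on the whole knowable family.**  A coset-non-demolition operation acts on EVERY
line ket `|φ_{b,w}⟩` (`b` a class secret, `w` in the knowable coset of `v′`) as the same scalar
`ndValue E b₁ v′` (`b₁` any class secret): whatever instrument is built from such operations has an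
outcome law that does not depend on the instance within the family.
[cite: ChenQuantumLattice2024, §3.5.9 pp. 34–38, Claim 3.14 pp. 33–34, eq. (12) p. 17] -/
theorem IsCosetND.apply_eq_smul (hE : IsCosetND n D p₁ Q U bk v' E)
    (hP : Odd ((p₁ * Q : ℕ+) : ℕ)) (hQ : Odd ((Q : ℕ+) : ℕ)) (hpQ : Nat.Coprime (p₁ : ℕ) (Q : ℕ))
    (hU : (0 : Fin (n + 1)) ∉ U) (hU' : U.Nonempty) (hbk0 : bk 0 = -1) {b₁ b : Fin (n + 1) → ℤ}
    (hb₁ : InClass n p₁ U bk b₁) (hb : InClass n p₁ U bk b) {w : Fin (n + 1) → ℤ}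
    (hw : SameCoset n D p₁ Q U bk v' w) :
    E (phi8bKet n D p₁ Q b w) = ndValue n D p₁ Q E b₁ v' • phi8bKet n D p₁ Q b w := by
  rw [← hE.ndValue_eq_of_sameCoset hP hQ hpQ hU hU' hbk0 hb₁ hb hw]
  exact (hE b hb w hw).eq_smul n D p₁ Q hP (InClass.apply_zero n p₁ hU hbk0 hb)

/-- **The hypothesis in knowable terms.**  For odd `p₁`, odd `Q`, `0 ∉ U`, `bk₀ = −1`, `2p₁ ∣ bk` on `U`:
`E` is coset-non-demolition at `v′` iff it is non-demolition on `|φ_{b,w}⟩` for every class secret `b`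
and every offset `w` that has the same value of every line invariant and the same Step-8 datum as `v′`
(`offset_indistinguishable_iff`). [cite: ChenQuantumLattice2024, Claim 3.14 pp. 33–34, §3.5.9 p. 35, eq. (12) p. 17] -/
theorem isCosetND_iff_knowable (hp : Odd ((p₁ : ℕ+) : ℕ)) (hQ : Odd ((Q : ℕ+) : ℕ))
    (hU : (0 : Fin (n + 1)) ∉ U) (hbk0 : bk 0 = -1) (hbk : ∀ i, i ∈ U → (2 * ((p₁ : ℕ) : ℤ)) ∣ bk i)
    (v' : Fin (n + 1) → ℤ)
    (E : Ket (n + 1) ((D * D * (p₁ * Q) : ℕ+) : ℕ) →ₗ[ℂ] Ket (n + 1) ((D * D * (p₁ * Q) : ℕ+) : ℕ)) :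
    IsCosetND n D p₁ Q U bk v' E
      ↔ ∀ b, InClass n p₁ U bk b → ∀ w : Fin (n + 1) → ℤ,
          ((∀ f : (Fin (n + 1) → ZN D p₁ Q) → Prop, IsLineInvariant n D p₁ Q U bk f →
              (f (fun i => ((v' i : ℤ) : ZN D p₁ Q)) ↔ f (fun i => ((w i : ℤ) : ZN D p₁ Q))))
            ∧ toStep8 D p₁ Q (((v' 0 : ℤ) : ZN D p₁ Q)) = toStep8 D p₁ Q (((w 0 : ℤ) : ZN D p₁ Q))) →
          IsNonDemolition E (phi8bKet n D p₁ Q b w) := by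
  refine forall_congr' fun b => forall_congr' fun _ => forall_congr' fun w => ?_
  rw [offset_indistinguishable_iff n D p₁ Q hp hQ U hU bk hbk0 hbk v' w]
  rfl

end CosetMain

/-! ### The coset-restricted hypothesis is strictly weaker than class-non-demolition -/

section Separation

variable {v' : Fin (n + 1) → ℤ}

/-- Every coordinate of a class shift is `≡ 0 (mod D²p₁)`. [cite: ChenQuantumLattice2024, Claim 3.14 pp. 33–34] -/
theorem toStep8_classShift_apply (a : ZQ Q) (c : Fin (n + 1) → ZQ Q) (i : Fin (n + 1)) :
    toStep8 D p₁ Q ((classShift n D p₁ Q U bk a c i : ℤ) : ZN D p₁ Q) = 0 := by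
  rw [toStep8_intCast, ZMod.intCast_zmod_eq_zero_iff_dvd]
  unfold classShift
  exact ⟨((a.val : ℕ) : ℤ) * bk i + ((classTail n Q U c i : ℕ) : ℤ), by push_cast; ring⟩

/-- On an unknown coordinate the datum `x_{i} mod D²p₁` is constant along the line of a class secret
(a line invariant). [cite: ChenQuantumLattice2024, §3.5.9 p. 35, eq. (12) p. 17] -/
theorem toStep8_ptB_of_mem {b : Fin (n + 1) → ℤ} (hb : InClass n p₁ U bk b) {i : Fin (n + 1)}
    (hi : i ∈ U) (w : Fin (n + 1) → ℤ) (j : ZP p₁ Q) :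
    toStep8 D p₁ Q (ptB n D p₁ Q b w j i) = toStep8 D p₁ Q (((w i : ℤ) : ZN D p₁ Q)) := by
  have h0 : toStep8 D p₁ Q (((2 * ((D : ℕ) : ℤ) ^ 2 * ((j.val : ℕ) : ℤ) * b i : ℤ)) : ZN D p₁ Q) = 0 := by
    obtain ⟨β, hβ⟩ := hb.2 i hi
    rw [toStep8_intCast, ZMod.intCast_zmod_eq_zero_iff_dvd, hβ]
    exact ⟨4 * ((j.val : ℕ) : ℤ) * β, by push_cast; ring⟩
  simp only [ptB]
  rw [Int.cast_add, map_add, h0, zero_add]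

/-- **Strictly weaker, I.**  If `x` differs from `v′` in the datum `x_{i₀} mod D²p₁` at an unknown
coordinate `i₀ ∈ U` (constant on the knowable coset and along its lines), then no line of the knowable
family passes through `x`: the single-point branch `𝟙_{x}` annihilates — so does not demolish — every
ket of the family; it is coset-non-demolition at `v′` (eigenvalue `0`). [folklore] -/
theorem isCosetND_branchOp_singleton {x : Fin (n + 1) → ZN D p₁ Q} {i₀ : Fin (n + 1)} (hi₀ : i₀ ∈ U)
    (hx : toStep8 D p₁ Q (x i₀) ≠ toStep8 D p₁ Q (((v' i₀ : ℤ) : ZN D p₁ Q))) :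
    IsCosetND n D p₁ Q U bk v' (branchOp {x}) := by
  classical
  intro b hb w hw
  refine ⟨0, ?_⟩
  rw [zero_smul, branchOp_apply]
  funext z
  rw [Set.indicator_apply, Pi.zero_apply]
  split_ifs with hz
  · rw [Set.mem_singleton_iff] at hz
    rw [hz]
    unfold phi8bKet
    refine lineKet_apply_of_ne _ _ fun j hj => hx ?_
    obtain ⟨a, c, hac⟩ := hw
    rw [hj, toStep8_ptB_of_mem hb hi₀ w j, hac i₀, Int.cast_add, map_add, toStep8_classShift_apply,
      add_zero]
  · rfl

/-- **Strictly weaker, II.**  The same branch `𝟙_{x}` is NOT class-non-demolition (`P > 1` odd,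
`0 ∉ U`, `bk₀ = −1`, the class non-empty): it maps the line ket of a class secret THROUGH `x` to `|x⟩`,
which is not a multiple of a ket with `P` points.  So `IsCosetND` is a strictly weaker hypothesis than
`IsClassND`, and `IsCosetND.ndValue_eq_of_sameCoset` strictly strengthens `IsClassND.ndValue_class_blind`.
[folklore] -/
theorem not_isClassND_branchOp_singleton (hP : Odd ((p₁ * Q : ℕ+) : ℕ)) (hP1 : 1 < ((p₁ * Q : ℕ+) : ℕ))
    (hU : (0 : Fin (n + 1)) ∉ U) (hbk0 : bk 0 = -1) {b₁ : Fin (n + 1) → ℤ} (hb₁ : InClass n p₁ U bk b₁)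
    (x : Fin (n + 1) → ZN D p₁ Q) : ¬ IsClassND n D p₁ Q U bk (branchOp {x}) := by
  classical
  intro hE
  haveI : Fact (1 < ((p₁ * Q : ℕ+) : ℕ)) := ⟨hP1⟩
  have hb0 := InClass.apply_zero n p₁ hU hbk0 hb₁
  set vx : Fin (n + 1) → ℤ := fun i => (((x i).val : ℕ) : ℤ) with hvx
  have hcast : (fun i => ((vx i : ℤ) : ZN D p₁ Q)) = x := by
    funext i
    simp only [hvx, Int.cast_natCast, ZMod.natCast_zmod_val]
  obtain ⟨l, hl⟩ := hE b₁ hb₁ vx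
  have h1 : phi8bKet n D p₁ Q b₁ vx x = 1 := by
    rw [← hcast]
    exact phi8bKet_apply_offset n D p₁ Q b₁ vx hP hb0
  have hx1 := congrFun hl x
  rw [branchOp_apply, Set.indicator_of_mem (Set.mem_singleton x), Pi.smul_apply, smul_eq_mul, h1,
    mul_one] at hx1
  have hne : ptB n D p₁ Q b₁ vx 1 ≠ x := by
    intro h
    rw [← hcast, ← ptB_zero] at h
    exact one_ne_zero (ptB_injective n D p₁ Q b₁ vx hP hb0 h)
  have h2 := congrFun hl (ptB n D p₁ Q b₁ vx 1)
  rw [branchOp_apply, Set.indicator_of_notMem (fun h => hne (Set.mem_singleton_iff.1 h)), Pi.smul_apply,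
    smul_eq_mul, ← hx1, one_mul] at h2
  unfold phi8bKet at h2
  rw [lineKet_apply_pt (ptB_injective n D p₁ Q b₁ vx hP hb0)] at h2
  exact chirp_ne_zero p₁ Q 1 h2.symm

end Separation

end Coset

end Literature.Computability.Cryptography.Chen2024

/-! ### Applied to an admissible shape -/

namespace Literature.Computability.Cryptography.Chen2024.Shape

open scoped BigOperators

variable (S : Shape)

/-- **N-12.4 for Chen's shapes.**  `S` admissible, `U` a non-empty set of unknown coordinates with
`0 ∉ U`, `bk` a public vector agreeing with `S.b` off `U`, `b₂` any class secret (another LWE instance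
with the same planted part): an operation that is merely non-demolition on the line kets of the class
secrets through the offsets of the KNOWABLE COSET of `v′` has the same eigenvalue on the true ket
`|φ_{S.b, v′}⟩` and on `|φ_{b₂, w}⟩` for every `w` in that coset.
[cite: ChenQuantumLattice2024, §3.5.9 pp. 34–38, Claim 3.14 pp. 33–34, eq. (12) p. 17, Cond. C.3 p. 18] -/
theorem coset_ndValue_class_blind (h : S.Admissible) (U : Finset (Fin (S.n + 1)))
    (hU : (0 : Fin (S.n + 1)) ∉ U) (hU' : U.Nonempty) (bk b₂ : Fin (S.n + 1) → ℤ)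
    (hbk : ∀ i, i ∉ U → bk i = S.b i) (hb₂ : ∀ i, i ∉ U → b₂ i = S.b i)
    (hb₂U : ∀ i ∈ U, (2 * (S.p₁ : ℤ)) ∣ b₂ i)
    (E : Ket (S.n + 1) ((S.D * S.D * (S.p₁ * S.Q) : ℕ+) : ℕ)
      →ₗ[ℂ] Ket (S.n + 1) ((S.D * S.D * (S.p₁ * S.Q) : ℕ+) : ℕ))
    (v' : Fin (S.n + 1) → ℤ) (hE : IsCosetND S.n S.D S.p₁ S.Q U bk v' E) {w : Fin (S.n + 1) → ℤ}
    (hw : SameCoset S.n S.D S.p₁ S.Q U bk v' w) :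
    ndValue S.n S.D S.p₁ S.Q E b₂ w = ndValue S.n S.D S.p₁ S.Q E S.b v' := by
  have hbk0 : bk 0 = -1 := by rw [hbk 0 hU, h.b_head]
  have hSb : InClass S.n S.p₁ U bk S.b :=
    ⟨fun i hi => (hbk i hi).symm, fun i hi => h.b_tail i (fun h0 => hU (h0 ▸ hi))⟩
  have hb₂' : InClass S.n S.p₁ U bk b₂ :=
    ⟨fun i hi => (hb₂ i hi).trans (hbk i hi).symm, fun i hi => hb₂U i hi⟩
  exact hE.ndValue_eq_of_sameCoset h.odd_P h.odd_Q h.cop_pQ hU hU' hbk0 hSb hb₂' hw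

end Literature.Computability.Cryptography.Chen2024.Shape
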